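import Literature.Probability.LatticeModels.TorusNegTypeBochner
import Literature.Probability.LatticeModels.TorusLevyKhintchine
import HarnessLib

/-!
# A discrete Pólya criterion on the finite torus

For a real function `f` on `(ℤ/Lℤ)^d` and a lattice vector `u`, summation by parts twice gives the
exact identity
`2 (1 - Re χ_k(u)) · Re ∑_x f(x) χ_k(x) = ∑_x (f(x+u) - 2f(x) + f(x-u)) (1 - Re χ_k(x))`.
Hence (**`torusFourier_re_nonneg_of_secondDiff_nonneg_off_zero`**): if the second difference of `f`
in direction `u` is nonnegative at every `x ≠ 0` ("convex away from the origin"; at `x = 0` the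
weight `1 - Re χ_k(0)` vanishes, so a concave kink at the origin is allowed) then
`∑_x f(x) Re χ_k(x) ≥ 0` for every `k` with `χ_k(u) ≠ 1`. For `d = 1`, `u = 1` this is the
classical discrete Pólya criterion on the cycle `ℤ/Lℤ`: an `L`-periodic sequence, convex on
`{1, …, L-1}`, has all its nonconstant Fourier cosine coefficients nonnegative
(**`cycle_fourierCos_nonneg_of_convex`**); combined with Bochner on the torus in negative-type form
(`isNegDefKernel_neg_sub_of_torusFourier_re_nonneg`, this directory) it turns log-convexity of a
positive even sequence into infinite divisibility of the kernel `g(a - b)` on the cycle — the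
"Pólya" step of the foreseen split `AxisInfDiv` of crux `Block2InfDivXXZ` (route `LevyLogBootstrap`,
summit HubbardSuperconductivity). Pólya (1949) / folklore; elementary.
-/

noncomputable section

open Finset Complex
open scoped BigOperators ComplexConjugate Real

namespace Literature.Probability.LatticeModels

variable {d L : ℕ} [NeZero L]

/-- A unimodular complex number other than `1` has real part `< 1`. [folklore] -/
theorem re_lt_one_of_norm_eq_one_of_ne_one {e : ℂ} (hn : ‖e‖ = 1) (h1 : e ≠ 1) : e.re < 1 := by
  have hle : e.re ≤ 1 := by
    have := Complex.re_le_norm e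
    rwa [hn] at this
  rcases hle.lt_or_eq with hlt | heq
  · exact hlt
  · exfalso
    apply h1
    have hsq : e.re * e.re + e.im * e.im = 1 := by
      have h := Complex.normSq_eq_norm_sq e
      rw [Complex.normSq_apply, hn] at h
      nlinarith [h]
    have him : e.im = 0 := by
      rw [heq] at hsq
      nlinarith [hsq]
    exact Complex.ext (by simp [heq]) (by simp [him])

/-- Shift of the summation variable against a character:
`∑_x f(x + u) χ_k(x) = conj χ_k(u) · ∑_x f(x) χ_k(x)`. [folklore] -/
theorem sum_shift_add_mul_torusChar (f : TorusSite d L → ℂ) (k u : TorusSite d L) :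
    ∑ x, f (x + u) * torusChar k x = conj (torusChar k u) * ∑ x, f x * torusChar k x := by
  have h1 : ∑ x, f (x + u) * torusChar k x = ∑ y, f y * torusChar k (y - u) := by
    have h := Equiv.sum_comp (Equiv.addRight u) (fun y => f y * torusChar k (y - u))
    simpa only [Equiv.coe_addRight, add_sub_cancel_right] using h
  rw [h1, Finset.mul_sum]
  refine Finset.sum_congr rfl fun x _ => ?_
  rw [torusChar_sub_right]
  ring

/-- Shift the other way: `∑_x f(x - u) χ_k(x) = χ_k(u) · ∑_x f(x) χ_k(x)`. [folklore] -/
theorem sum_shift_sub_mul_torusChar (f : TorusSite d L → ℂ) (k u : TorusSite d L) :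
    ∑ x, f (x - u) * torusChar k x = torusChar k u * ∑ x, f x * torusChar k x := by
  have h1 : ∑ x, f (x - u) * torusChar k x = ∑ y, f y * torusChar k (y + u) := by
    have h := Equiv.sum_comp (Equiv.subRight u) (fun y => f y * torusChar k (y + u))
    simpa only [Equiv.subRight_apply, sub_add_cancel] using h
  rw [h1, Finset.mul_sum]
  refine Finset.sum_congr rfl fun x _ => ?_
  rw [torusChar_add_right]
  ring

/-- Sums over the torus are shift invariant: `∑_x f(x + u) = ∑_x f(x)`. [folklore] -/
theorem sum_shift_add (f : TorusSite d L → ℂ) (u : TorusSite d L) :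
    ∑ x, f (x + u) = ∑ x, f x :=
  Equiv.sum_comp (Equiv.addRight u) f

/-- `∑_x f(x - u) = ∑_x f(x)`. [folklore] -/
theorem sum_shift_sub (f : TorusSite d L → ℂ) (u : TorusSite d L) :
    ∑ x, f (x - u) = ∑ x, f x :=
  Equiv.sum_comp (Equiv.subRight u) f

/-- **Summation by parts, twice, against a character.** For real `f` and the second
difference `D f(x) = f(x+u) - 2 f(x) + f(x-u)`:
`2 (1 - Re χ_k(u)) · ∑_x f(x) Re χ_k(x) = ∑_x D f(x) · (1 - Re χ_k(x))`. [folklore] -/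
theorem two_mul_one_sub_re_mul_fourierRe_eq (f : TorusSite d L → ℝ) (k u : TorusSite d L) :
    2 * (1 - (torusChar k u).re) * ∑ x, f x * (torusChar k x).re =
      ∑ x, (f (x + u) - 2 * f x + f (x - u)) * (1 - (torusChar k x).re) := by
  -- complex sums
  set S : ℂ := ∑ x, (f x : ℂ) * torusChar k x with hS
  set e : ℂ := torusChar k u with he
  have hD : ∑ x, ((f (x + u) - 2 * f x + f (x - u) : ℝ) : ℂ) * torusChar k x =
      (e + conj e - 2) * S := by
    have h1 := sum_shift_add_mul_torusChar (fun x => (f x : ℂ)) k u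
    have h2 := sum_shift_sub_mul_torusChar (fun x => (f x : ℂ)) k u
    have : ∀ x, ((f (x + u) - 2 * f x + f (x - u) : ℝ) : ℂ) * torusChar k x =
        (f (x + u) : ℂ) * torusChar k x - 2 * ((f x : ℂ) * torusChar k x) +
          (f (x - u) : ℂ) * torusChar k x := fun x => by
      push_cast
      ring
    simp_rw [this]
    rw [Finset.sum_add_distrib, Finset.sum_sub_distrib, ← Finset.mul_sum, h1, h2, hS, he]
    ring
  have hD' : ∑ x, ((f (x + u) - 2 * f x + f (x - u) : ℝ) : ℂ) * torusChar k x =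
      ∑ x, ((f (x + u) - 2 * f x + f (x - u) : ℝ) : ℂ) * (torusChar k x - 1) := by
    have hzero : ∑ x, ((f (x + u) - 2 * f x + f (x - u) : ℝ) : ℂ) = 0 := by
      have h1 := sum_shift_add (fun x => (f x : ℂ)) u
      have h2 := sum_shift_sub (fun x => (f x : ℂ)) u
      push_cast
      rw [Finset.sum_add_distrib, Finset.sum_sub_distrib, h1, h2, ← Finset.mul_sum]
      ring
    have : ∑ x, ((f (x + u) - 2 * f x + f (x - u) : ℝ) : ℂ) * (torusChar k x - 1) =
        ∑ x, ((f (x + u) - 2 * f x + f (x - u) : ℝ) : ℂ) * torusChar k x -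
          ∑ x, ((f (x + u) - 2 * f x + f (x - u) : ℝ) : ℂ) := by
      rw [← Finset.sum_sub_distrib]
      exact Finset.sum_congr rfl fun x _ => by ring
    rw [this, hzero, sub_zero]
  -- take real parts of `(e + conj e - 2) S = ∑ D (χ - 1)`
  have hre := congrArg Complex.re (hD.symm.trans hD')
  have hl : ((e + conj e - 2) * S).re = 2 * ((torusChar k u).re - 1) * ∑ x, f x * (torusChar k x).re := by
    have hec : e + conj e - 2 = ((2 * e.re - 2 : ℝ) : ℂ) := by
      rw [Complex.add_conj]
      push_cast
      ring
    rw [hec, Complex.re_ofReal_mul, hS, Complex.re_sum]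
    simp only [Complex.re_ofReal_mul, he]
    ring
  have hr : (∑ x, ((f (x + u) - 2 * f x + f (x - u) : ℝ) : ℂ) * (torusChar k x - 1)).re =
      ∑ x, (f (x + u) - 2 * f x + f (x - u)) * ((torusChar k x).re - 1) := by
    rw [Complex.re_sum]
    refine Finset.sum_congr rfl fun x _ => ?_
    rw [Complex.re_ofReal_mul, Complex.sub_re, Complex.one_re]
  rw [hl, hr] at hre
  have : ∑ x, (f (x + u) - 2 * f x + f (x - u)) * (1 - (torusChar k x).re) =
      -∑ x, (f (x + u) - 2 * f x + f (x - u)) * ((torusChar k x).re - 1) := by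
    rw [← Finset.sum_neg_distrib]
    exact Finset.sum_congr rfl fun x _ => by ring
  rw [this, ← hre]
  ring

/-- **Discrete Pólya criterion on the torus (directional form).** If the second difference of a
real function `f` on `(ℤ/Lℤ)^d` in direction `u` is nonnegative at every nonzero site,
`2 f(x) ≤ f(x+u) + f(x-u)` for `x ≠ 0`, then `∑_x f(x) Re χ_k(x) ≥ 0` for every momentum `k` with
`χ_k(u) ≠ 1`. (Pólya 1949 for the real line; the cycle/torus version is folklore.) [folklore] -/
theorem torusFourier_re_nonneg_of_secondDiff_nonneg_off_zero (f : TorusSite d L → ℝ)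
    (u : TorusSite d L) (hconv : ∀ x : TorusSite d L, x ≠ 0 → 2 * f x ≤ f (x + u) + f (x - u))
    (k : TorusSite d L) (hk : torusChar k u ≠ 1) :
    0 ≤ ∑ x, f x * (torusChar k x).re := by
  have hid := two_mul_one_sub_re_mul_fourierRe_eq f k u
  have hrhs : 0 ≤ ∑ x, (f (x + u) - 2 * f x + f (x - u)) * (1 - (torusChar k x).re) := by
    refine Finset.sum_nonneg fun x _ => ?_
    by_cases hx : x = 0
    · rw [hx, torusChar_zero_right, Complex.one_re, sub_self, mul_zero]
    · exact mul_nonneg (by linarith [hconv x hx]) (by linarith [TorusLevyKhintchine.re_torusChar_le_one k x])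
  have hpos : 0 < 2 * (1 - (torusChar k u).re) := by
    have := re_lt_one_of_norm_eq_one_of_ne_one (norm_torusChar k u) hk
    linarith
  rw [← hid] at hrhs
  exact (mul_nonneg_iff_of_pos_left hpos).mp hrhs

/-! ### The cycle `ℤ/Lℤ` (`d = 1`) -/

/-- `χ_k(n • u) = χ_k(u)^n`. [folklore] -/
theorem torusChar_nsmul_right (k u : TorusSite d L) (n : ℕ) :
    torusChar k (n • u) = torusChar k u ^ n := by
  induction n with
  | zero => simp
  | succ n ih => rw [succ_nsmul, torusChar_add_right, ih, pow_succ]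

/-- On the cycle, `χ_k(1) = 1` only for `k = 0` (`d = 1`, unit vector `u = 1`): every site is a
multiple of `u`, so `χ_k ≡ 1`, and character orthogonality forces `k = 0`. [folklore] -/
theorem torusChar_one_eq_one_iff (k : TorusSite 1 L) : torusChar k (fun _ => 1) = 1 ↔ k = 0 := by
  constructor
  · intro h
    have hall : ∀ x : TorusSite 1 L, torusChar k x = 1 := by
      intro x
      have hx : x = (x 0).val • (fun _ : Fin 1 => (1 : ZMod L)) := by
        funext i
        rw [Subsingleton.elim i 0, Pi.smul_apply, nsmul_eq_mul, mul_one, ZMod.natCast_zmod_val]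
      rw [hx, torusChar_nsmul_right, h, one_pow]
    have hsum := sum_torusChar_right (d := 1) (L := L) k
    by_contra hk
    rw [if_neg hk] at hsum
    simp only [hall, Finset.sum_const, Finset.card_univ, nsmul_eq_mul, mul_one,
      Nat.cast_eq_zero, Fintype.card_eq_zero_iff] at hsum
    exact hsum.false fun _ => 0
  · intro h
    rw [h]
    exact torusChar_zero_left _

/-- **Discrete Pólya criterion on the cycle `ℤ/Lℤ`.** If `f : ℤ/Lℤ → ℝ` (as a function on the
one-dimensional torus) satisfies `2 f(x) ≤ f(x+1) + f(x-1)` for every `x ≠ 0`, then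
`∑_x f(x) Re χ_k(x) ≥ 0` for every `k ≠ 0`. With `f` even this makes `(a, b) ↦ -f(a - b)` a
negative definite kernel up to the constant mode (`isNegDefKernel_neg_sub_of_torusFourier_re_nonneg`).
[folklore] -/
theorem cycle_fourierCos_nonneg_of_convex (f : TorusSite 1 L → ℝ)
    (hconv : ∀ x : TorusSite 1 L, x ≠ 0 → 2 * f x ≤ f (x + fun _ => 1) + f (x - fun _ => 1))
    (k : TorusSite 1 L) (hk : k ≠ 0) :
    0 ≤ ∑ x, f x * (torusChar k x).re :=
  torusFourier_re_nonneg_of_secondDiff_nonneg_off_zero f (fun _ => 1) hconv k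
    (fun h => hk ((torusChar_one_eq_one_iff k).mp h))

/-- **Log-convex positive even sequences give negative-type log-kernels on the cycle** (the
Pólya step of axis infinite divisibility): if `g : ℤ/Lℤ → ℝ` is positive, even, and `log g` is
convex away from `0` (`g(x)² ≤ g(x+1) g(x-1)` for `x ≠ 0`), then `(a, b) ↦ -log g(a - b)` is a
negative definite kernel, i.e. `g(a - b)` is infinitely divisible (Schoenberg). [folklore] -/
theorem isNegDefKernel_negLog_sub_of_logConvex (g : TorusSite 1 L → ℝ) (hpos : ∀ x, 0 < g x)
    (heven : ∀ x, g (-x) = g x)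
    (hlc : ∀ x : TorusSite 1 L, x ≠ 0 → g x ^ 2 ≤ g (x + fun _ => 1) * g (x - fun _ => 1)) :
    Literature.Analysis.Matrix.IsNegDefKernel fun a b : TorusSite 1 L => -Real.log (g (a - b)) := by
  refine isNegDefKernel_neg_sub_of_torusFourier_re_nonneg (fun x => Real.log (g x))
    (fun x => by simp only [heven]) fun k hk => ?_
  refine cycle_fourierCos_nonneg_of_convex _ (fun x hx => ?_) k hk
  have h := Real.log_le_log (pow_pos (hpos x) 2) (hlc x hx)
  rw [Real.log_pow, Real.log_mul (hpos _).ne' (hpos _).ne'] at h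
  simpa only [Nat.cast_ofNat] using h

end Literature.Probability.LatticeModels

end
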